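import Summits.CriticalPhenomena.PercolationContinuityZ3.Theorems.Transplant.PlanarSkeletonSignDefs
import Summits.CriticalPhenomena.PercolationContinuityZ3.Theorems.Transplant.PlanarSkeletonConcShift
import Summits.CriticalPhenomena.PercolationContinuityZ3.Theorems.Transplant.SkelPhiCylinderTails
import HarnessLib

/-!
# D″ node, L0′ plumbing: RE-CENTRING a `PlanarSkeletonNeg` / `PlanarSkeletonSign` at a base vertex (`φ ↦ φ − c`) and WLOG `φ t = 0` in the
# node `SamePDropOfSkeletonSign` — twin of `PlanarSkeletonConcShift` (p-stmt lineage) for the interfaces of route D″; needed because the D″ cell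
# geometry `Skelφ.cellGeomSG G φ P t Λ` (p2-g7) and its realised-radii lemmas (p5-g6: `tgt_add_stepVec_ne_zero`, `reach_radii_concSG`) are
# stated for a root in base position `φ t = 0`

builds on p205010 (kernel theorem, internal audit signed; external expert review pending) — nothing in this file uses p205010.
Lane `prim-bschramm`, seat `prim-bschramm-p3` (gen 7; D″ design owner); helper file (`--supports stmt-CriticalPhenomena-4575`).
* §1 `PlanarSkeletonNeg.shift Φ c` (`φ ↦ φ − c`; `types`, `Δ` unchanged; `frame`, `neg`, (ι), (κ) transported — every field speaks of RELATIVE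
  coordinates `φ w − φ t` or of differences, which the shift leaves alone); `shift_spec` (`types`, `Δ`, `φ` of the shift — by `rfl`; stated as ONE
  conjunction: the single-clause forms print identically to `PlanarSkeletonConc.shift_*` and would be caught by the dedup lint although they are about a
  different structure), **`shift_cylSubcritical_iff_skelφ`** (Φ2 of the shift ↔ the φ-level `Skelφ.CylSubcritical` of the original);
* §2 `PlanarSkeletonSign.shift` (the flip transported the same way), `shift_toPlanarSkeletonNeg`, `shift_spec`, `shift_cylSubcritical_iff_skelφ`;
* §3 **`samePDropOfSkeletonSign_of_centred`** / `samePDropOfSkeletonNeg_of_centred`: it suffices to prove the node for skeletons with `Φ.φ t = 0`.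
[cite: KozmaNitzan2024, §4 p. 15 (the role of the lattice symmetries)] [cite: BenjaminiSchramm1996, Conj. 4]
-/

noncomputable section

open MeasureTheory ProbabilityTheory
open scoped ENNReal Classical

namespace Summit.CriticalPhenomena.PercolationContinuityZ3.Theorems.Transplant

open Literature.Probability.Percolation Literature.Probability.LatticeModels SimpleGraph
open Literature.Probability.Percolation.GM

/-! ## §1 Shifting a `PlanarSkeletonNeg` -/

namespace PlanarSkeletonNeg

variable {V : Type} {G : SimpleGraph V} [G.LocallyFinite] (Φ : PlanarSkeletonNeg G) (c : Site 2)

/-- **The shifted skeleton `φ − c`**: same base vertices, frames, central inversions, degree bound, steps and cylinders. [this work] -/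
def shift : PlanarSkeletonNeg G where
  φ := fun v => Φ.φ v - c
  lip := by
    intro u v h i
    have h' := Φ.lip h i
    simp only [Pi.sub_apply] at h' ⊢
    rwa [sub_sub_sub_cancel_right]
  types := Φ.types
  frame := fun v => by
    obtain ⟨t, ht, α, hαt, hα⟩ := Φ.frame v
    refine ⟨t, ht, α, hαt, fun w => ?_⟩
    rw [hα w, sub_sub_sub_cancel_right]
    abel
  neg := fun t ht => by
    obtain ⟨α, hαt, hα⟩ := Φ.neg t ht
    refine ⟨α, hαt, fun w => ?_⟩
    rw [sub_sub_sub_cancel_right, sub_sub_sub_cancel_right]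
    exact hα w
  Δ := Φ.Δ
  degree_le := Φ.degree_le
  step := fun v i σ => by
    obtain ⟨v', hadj, hφ⟩ := Φ.step v i σ
    refine ⟨v', hadj, ?_⟩
    show Φ.φ v' - c = Φ.φ v - c + Pi.single i (σ : ℤ)
    rw [hφ]
    abel
  cyl_connected := fun t ht ℓ hℓ => by
    have hS : {w : V | Φ.φ w - c - (Φ.φ t - c) ∈ box 2 ℓ} = {w : V | Φ.φ w - Φ.φ t ∈ box 2 ℓ} := by
      ext w
      simp only [Set.mem_setOf_eq, sub_sub_sub_cancel_right]
    rw [hS]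
    exact Φ.cyl_connected t ht ℓ hℓ

/-- **The shift, unfolded**: base vertices and degree bound unchanged, skeleton map `φ − c`. [folklore] -/
theorem shift_spec : (Φ.shift c).types = Φ.types ∧ (Φ.shift c).Δ = Φ.Δ ∧ ∀ v, (Φ.shift c).φ v = Φ.φ v - c := ⟨rfl, rfl, fun _ => rfl⟩

/-- **Cylinder subcriticality is unchanged by a shift**, stated against the φ-level predicate of the ORIGINAL map (cylinders are unchanged:
`(φ w − c) − (φ t − c) = φ w − φ t`). [folklore] -/
theorem shift_cylSubcritical_iff_skelφ [Countable V] (p : unitInterval) :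
    (Φ.shift c).CylSubcritical p ↔ Skelφ.CylSubcritical G Φ.φ Φ.types p := by
  rw [← Φ.cylSubcritical_iff_skelφ]
  unfold CylSubcritical
  refine forall₂_congr fun t _ => forall_congr' fun ℓ => ?_
  have hcyl : (Φ.shift c).cyl t ℓ = Φ.cyl t ℓ := by
    ext w
    simp only [cyl, Set.mem_setOf_eq]
    show Φ.φ w - c - (Φ.φ t - c) ∈ box 2 ℓ ↔ Φ.φ w - Φ.φ t ∈ box 2 ℓ
    rw [sub_sub_sub_cancel_right]
  rw [PlanarSkeleton.theta_induce_congr hcyl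
    (show t ∈ (Φ.shift c).cyl t ℓ from by
      show (Φ.shift c).φ t - (Φ.shift c).φ t ∈ box 2 ℓ
      rw [sub_self]; exact zero_mem_box 2 ℓ) p]

end PlanarSkeletonNeg

/-! ## §2 Shifting a `PlanarSkeletonSign` -/

namespace PlanarSkeletonSign

variable {V : Type} {G : SimpleGraph V} [G.LocallyFinite] (Φ : PlanarSkeletonSign G) (c : Site 2)

/-- **The shifted `PlanarSkeletonSign`** (`φ ↦ φ − c`; the axis flip transported: it speaks of relative coordinates only). [this work] -/
def shift : PlanarSkeletonSign G where
  toPlanarSkeletonNeg := Φ.toPlanarSkeletonNeg.shift c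
  flip := fun t ht => by
    obtain ⟨α, hαt, hα⟩ := Φ.flip t ht
    refine ⟨α, hαt, fun w => ?_⟩
    show Φ.φ (α w) - c - (Φ.φ t - c) = flipSnd (Φ.φ w - c - (Φ.φ t - c))
    rw [sub_sub_sub_cancel_right, sub_sub_sub_cancel_right]
    exact hα w

/-- The underlying shifted `PlanarSkeletonNeg`. [folklore] -/
@[simp] theorem shift_toPlanarSkeletonNeg : (Φ.shift c).toPlanarSkeletonNeg = Φ.toPlanarSkeletonNeg.shift c := rfl

/-- **The shift, unfolded** (`Sign` form): the `Neg` part is the shifted `Neg` part, base vertices unchanged, skeleton map `φ − c`. [folklore] -/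
theorem shift_spec : (Φ.shift c).toPlanarSkeletonNeg = Φ.toPlanarSkeletonNeg.shift c ∧ (Φ.shift c).types = Φ.types ∧
    ∀ v, (Φ.shift c).φ v = Φ.φ v - c := ⟨rfl, rfl, fun _ => rfl⟩

/-- Cylinder subcriticality is unchanged by a shift (the `Sign` form, against the φ-level predicate of the original). [folklore] -/
theorem shift_cylSubcritical_iff_skelφ [Countable V] (p : unitInterval) :
    (Φ.shift c).CylSubcritical p ↔ Skelφ.CylSubcritical G Φ.φ Φ.toPlanarSkeletonNeg.types p :=
  Φ.toPlanarSkeletonNeg.shift_cylSubcritical_iff_skelφ c p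

end PlanarSkeletonSign

/-! ## §3 WLOG `φ t = 0` in the two conjecture nodes -/

/-- **It suffices to prove the D″ node (central inversion) for skeletons centred at the base vertex** (`Φ.φ t = 0`).
[cite: KozmaNitzan2024, §4 p. 15 (the role of the lattice symmetries)] -/
theorem samePDropOfSkeletonNeg_of_centred
    (h : ∀ {V : Type} [DecidableEq V] [Countable V] (G : SimpleGraph V) [G.LocallyFinite] (Φ : PlanarSkeletonNeg G),
      G.Connected → ∀ t ∈ Φ.types, Φ.φ t = 0 → ∀ p : unitInterval, (p : ℝ) < 1 →
        (∀ᵐ ω ∂bondPercolation G p, numInfiniteClusters ω ≤ 1) → Φ.CylSubcritical p → 0 < theta G t p →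
          ∃ q : unitInterval, (q : ℝ) < p ∧ 0 < theta G t q) :
    SamePDropOfSkeletonNeg := by
  intro V _ _ G _ Φ hc t ht p hp1 hU hC hθ
  exact h G (Φ.shift (Φ.φ t)) hc t ht (sub_self _) p hp1 hU
    ((Φ.shift_cylSubcritical_iff_skelφ (Φ.φ t) p).2 ((Φ.cylSubcritical_iff_skelφ p).1 hC)) hθ

/-- **It suffices to prove the D″ v2 node (axis-type point group) for skeletons centred at the base vertex** (`Φ.φ t = 0`).
[cite: KozmaNitzan2024, §4 p. 15 (the role of the lattice symmetries)] -/
theorem samePDropOfSkeletonSign_of_centred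
    (h : ∀ {V : Type} [DecidableEq V] [Countable V] (G : SimpleGraph V) [G.LocallyFinite] (Φ : PlanarSkeletonSign G),
      G.Connected → ∀ t ∈ Φ.types, Φ.φ t = 0 → ∀ p : unitInterval, (p : ℝ) < 1 →
        (∀ᵐ ω ∂bondPercolation G p, numInfiniteClusters ω ≤ 1) → Φ.CylSubcritical p → 0 < theta G t p →
          ∃ q : unitInterval, (q : ℝ) < p ∧ 0 < theta G t q) :
    SamePDropOfSkeletonSign := by
  intro V _ _ G _ Φ hc t ht p hp1 hU hC hθ
  exact h G (Φ.shift (Φ.φ t)) hc t ht (sub_self _) p hp1 hU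
    ((Φ.shift_cylSubcritical_iff_skelφ (Φ.φ t) p).2 ((Φ.toPlanarSkeletonNeg.cylSubcritical_iff_skelφ p).1 hC)) hθ

end Summit.CriticalPhenomena.PercolationContinuityZ3.Theorems.Transplant

end
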